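import Mathlib.CategoryTheory.IsConnected
import Literature.AlgebraicGeometry.Frobenioids.Categories
import Literature.AlgebraicGeometry.Frobenioids.PerfFactorial
import Literature.AnabelianGeometry.EtaleTheta.DivisorMonoids

/-!
# [EtTh] §3, part 3: Definition 3.6 — tempered Frobenioids

Source: [MochizukiEtTh2009] §3, Definition 3.6 (i)–(v), PDF pp. 76–78 (printed 302–304).
Locators `p.N` = PDF page of the PRIMS text.

## How Definition 3.6 is typed

(i) (p.76) attaches to a *monoid type* `Λ ∈ {ℤ, ℚ, ℝ}` ([FrdI] §0; the tree's
`Frobenioids.MonoidType`) the variants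
`Φ₀^ℤ = Φ₀`, `Φ₀^ℚ = Φ₀^pf`, `Φ₀^ℝ = Φ₀^rlf`; `B₀^ℤ = B₀`, `B₀^ℚ = B₀^pf`, `B₀^ℝ = ℝ·Φ₀^birat ⊆ (Φ₀^ℝ)^gp`;
`F₀^ℤ = F₀`, `F₀^ℚ = F₀^pf`, `F₀^ℝ = ℝ·Φ₀^cnst ⊆ (Φ₀^ℝ)^gp`. The perfection `M^pf` is in the tree
(`Frobenioids/Monoids.lean`); the *realification* `M^rlf` of a perf-factorial monoid and the
`ℝ`-vector-space structure of `(M^rlf)^gp` are [FrdI] Def. 2.4 (i) (seat abc-iut-L1-t2, not yet in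
the tree). Therefore the realified data that (ii) actually consumes — `Φ₀^ℝ` with `Φ₀ → Φ₀^ℝ`,
`B₀^Λ → (Φ₀^ℝ)^gp`, `F₀^Λ ⊆ B₀^Λ`, `ℝ·Φ₀^cnst ⊆ (Φ₀^ℝ)^gp` — is recorded as the DATA structure
`RealifiedDivisorMonoids` extending `DivisorMonoids` (Def. 3.3 (iii)), each field quoting (i), with
the realification property expressed through the hypothesis vocabulary `FrdIMonoidStub`
(TODO-merge(abc-iut-L1-t2)).

(ii) (pp.76–77) is then a genuine `structure TemperedFrobenioid`: a connected, totally epimorphic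
category `D` with a functor `D → D₀`, a subfunctor `Φ ⊆ Φ^{ℝ-log} := Φ₀^ℝ|_D` (objectwise
submonoids stable under pull-back) which is group-saturated (REAL, §0), perf-factorial and a
divisorial monoid on `D` (vocabulary fields), with (a) `Φ^{bs-fld} := (ℝ·Φ₀^cnst)|_D ×_{(Φ^{ℝ-log})^gp} Φ`
monoprime (REAL: `Frobenioids.IsMonoprime`) and (b) `F := F₀^Λ|_D ×_{(Φ^{ℝ-log})^gp} Φ^gp → (Φ^{bs-fld})^gp`
objectwise nonzero. The OUTPUT "the data `(D, Φ, B, B → Φ^gp)` determines a model Frobenioid `C`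
[cf. [FrdI], Theorem 5.2, (ii)]" is provided objectwise (`divisorMonoid`, `ratFn`, `divB`); the
model-Frobenioid CATEGORY is [FrdI] Thm. 5.2 (i) = `Frobenioids.ModelFrobenioid` of seat
abc-iut-L1-t2 (p403817, not yet landed) — TODO-merge(abc-iut-L1-t2): `C := ModelFrobenioid Φ B DivB`.
(iii)–(v) (pp.77–78) are real definitions over this structure. ERRATUM E2 ([IUTchI] Rmk 3.2.4
(v), kurims pp.76–77): with IUT's approach (A) ("log-meromorphic" := tempered-meromorphic) "the
approach of (A) results in a slightly different definition of the notion of a 'tempered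
Frobenioid'": only the data `B₀` changes, not the shape of this definition.

v2 (seat abc-iut-L2-t3, one-writer touch; v1 declarations byte-identical): three ADDITIVE fields of
`RealifiedDivisorMonoids` recording printed properties of the Def. 3.6 (i) data that v1 left free —
`isUnit_BΛ` (`B₀^Λ` group-like), `cnstR_root` (`ℝ·Φ₀^cnst` root-closed: the "`ℝ`-vector subspace" clause;
R-9 finding of abc-iut-L2-d2 on Rmk 3.6.4), `cnst_le_cnstR` (`Φ₀^cnst ⊆ ℝ·Φ₀^cnst`) — plus two lemmas.
-/

namespace Literature.AnabelianGeometry.EtaleTheta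

open CategoryTheory Opposite Literature.AlgebraicGeometry.Frobenioids

universe u₀ v₀ u v w

/-! ## Subfunctors in submonoids of a monoid on a category (plumbing for "`Φ ⊆ Φ^{ℝ-log}`") -/

section SubMonoidOn

variable {D : Type u} [Category.{v} D]

/-- A *subfunctor in monoids* of a monoid `Ψ` on `D` (Def. 3.6 (ii), p.76: "`Φ ⊆ Φ^{ℝ-log}` … a
… subfunctor in monoids"): objectwise submonoids stable under the pull-back maps.
[cite: MochizukiEtTh2009, Def 3.6 p.76] -/
structure SubMonoidOn (Ψ : Dᵒᵖ ⥤ CommMonCat.{w}) : Type (max u v w) where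
  /-- the submonoid `Φ(A) ⊆ Ψ(A)` -/
  carrier : ∀ A : Dᵒᵖ, Submonoid (Ψ.obj A)
  /-- stability under pull-back -/
  map_mem : ∀ {A B : Dᵒᵖ} (f : A ⟶ B) (x : Ψ.obj A), x ∈ carrier A → (Ψ.map f).hom x ∈ carrier B

namespace SubMonoidOn

variable {Ψ : Dᵒᵖ ⥤ CommMonCat.{w}} (S : SubMonoidOn Ψ)

/-- The pull-back map of a subfunctor in monoids, `Φ(A) → Φ(B)` along `f`.
[cite: MochizukiEtTh2009, Def 3.6 p.76] -/
def pull {A B : Dᵒᵖ} (f : A ⟶ B) : S.carrier A →* S.carrier B :=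
  ((Ψ.map f).hom.restrict (S.carrier A)).codRestrict (S.carrier B) fun x => S.map_mem f x.1 x.2

/-- Values of `pull`. [cite: MochizukiEtTh2009, Def 3.6 p.76] -/
@[simp] theorem coe_pull {A B : Dᵒᵖ} (f : A ⟶ B) (x : S.carrier A) :
    ((S.pull f x : S.carrier B) : Ψ.obj B) = (Ψ.map f).hom x := rfl

/-- A subfunctor in monoids is itself a monoid on `D` (a functor `Dᵒᵖ ⥤ CommMonCat`).
[cite: MochizukiEtTh2009, Def 3.6 p.76] -/
def toFunctor : Dᵒᵖ ⥤ CommMonCat.{w} where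
  obj A := CommMonCat.of (S.carrier A)
  map f := CommMonCat.ofHom (S.pull f)
  map_id A := by
    apply CommMonCat.hom_ext
    ext x
    simp [pull]
  map_comp f g := by
    apply CommMonCat.hom_ext
    ext x
    simp [pull]

/-- Intersection of a subfunctor in monoids with objectwise submonoids that are themselves stable
under pull-back (used for `Φ^{bs-fld}`, p.77). [cite: MochizukiEtTh2009, Def 3.6 p.77] -/
def inter (R : ∀ A : Dᵒᵖ, Submonoid (Ψ.obj A))
    (hR : ∀ {A B : Dᵒᵖ} (f : A ⟶ B) (x : Ψ.obj A), x ∈ R A → (Ψ.map f).hom x ∈ R B) :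
    SubMonoidOn Ψ where
  carrier A := S.carrier A ⊓ R A
  map_mem f x hx := ⟨S.map_mem f x hx.1, hR f x hx.2⟩

end SubMonoidOn

end SubMonoidOn

/-! ## Definition 3.6 (i) (p.76): monoid types and the realified data -/

/-! The *monoid type* `Λ ∈ {ℤ, ℚ, ℝ}` of Def 3.6 (i) is [FrdI] §0's notion:
`Literature.AlgebraicGeometry.Frobenioids.MonoidType` (file `Frobenioids/PerfFactorial.lean`). -/

variable {D₀ : Type u₀} [Category.{v₀} D₀]

/-- **Definition 3.6 (i)** (p.76), the realified data at monoid type `Λ`: on top of the data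
`(Φ₀, B₀, B₀ → Φ₀^gp, F₀)` of Definition 3.3 (iii), the monoid `Φ₀^ℝ := Φ₀^rlf` on `D₀` "where
`Φ₀^rlf` is as in [FrdI], Definition 2.4, (i) [cf. Proposition 3.4, (i)]" with its map from `Φ₀`,
the monoid `B₀^Λ` (`= B₀`, `B₀^pf`, or `ℝ·Φ₀^birat ⊆ (Φ₀^ℝ)^gp` according as `Λ = ℤ, ℚ, ℝ`) with its
homomorphism to `(Φ₀^ℝ)^gp`, the subfunctor `F₀^Λ ⊆ B₀^Λ` (`= F₀`, `F₀^pf`, `ℝ·Φ₀^cnst`), and the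
submonoid `ℝ·Φ₀^cnst ⊆ (Φ₀^ℝ)^gp`; also the non-cuspidal/cuspidal submonoids of `Φ₀^ℝ` (Def 3.6
(iii)). DATA (the realification and `ℝ`-spans are [FrdI] Def 2.4 (i), seat abc-iut-L1-t2); the
field `isRealification` ties `Φ₀^ℝ` to `Φ₀` through the vocabulary `V`.
[cite: MochizukiEtTh2009, Def 3.6 p.76] -/
structure RealifiedDivisorMonoids (V : FrdIMonoidStub.{w}) extends DivisorMonoids.{u₀, v₀, w} D₀ where
  /-- the monoid type `Λ` of the data -/
  Λ : MonoidType
  /-- `Φ₀^ℝ := Φ₀^rlf`, a monoid on `D₀` -/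
  ΦR : D₀ᵒᵖ ⥤ CommMonCat.{w}
  /-- the natural map `Φ₀ → Φ₀^pf → Φ₀^rlf = Φ₀^ℝ`, objectwise -/
  toR : ∀ Y : D₀ᵒᵖ, (Φ₀.obj Y : Type w) →* ΦR.obj Y
  /-- naturality of `Φ₀ → Φ₀^ℝ` -/
  toR_natural : ∀ {Y Y' : D₀ᵒᵖ} (f : Y ⟶ Y') (x : Φ₀.obj Y),
    toR Y' ((Φ₀.map f).hom x) = (ΦR.map f).hom (toR Y x)
  /-- `Φ₀^ℝ(Y)` is the realification of `Φ₀(Y)` via `toR` ([FrdI] Def 2.4 (i)) -/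
  isRealification : ∀ Y : D₀ᵒᵖ, V.IsRealification (Φ₀.obj Y) (ΦR.obj Y) (toR Y)
  /-- `B₀^Λ` (Def 3.6 (i): `B₀^ℤ = B₀`, `B₀^ℚ = B₀^pf`, `B₀^ℝ = ℝ·Φ₀^birat`) -/
  BΛ : D₀ᵒᵖ ⥤ CommMonCat.{w}
  /-- `B₀^Λ(Y)` is group-like: every element is a unit (Def 3.6 (i), p.76: `B₀^Λ` is the group of
  log-meromorphic functions `B₀` [Def 3.3 (iii); field `isUnit_B₀`], its perfection `B₀^pf`, or the
  `ℝ`-vector subspace `ℝ·Φ₀^birat ⊆ (Φ₀^ℝ)^gp` — a group in each case).  (v2: additive field; v1 left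
  this printed property unrecorded, so that Theorem 3.7 (i) "of isotropic type" had to carry it as the
  hypothesis `hB` of `Discharge/Sec3Thm37.lean`.) -/
  isUnit_BΛ : ∀ (Y : D₀ᵒᵖ) (b : BΛ.obj Y), IsUnit b
  /-- the homomorphism `B₀^Λ → (Φ₀^ℝ)^gp` induced by `B₀ → Φ₀^gp → (Φ₀^ℝ)^gp`, objectwise -/
  divΛ : ∀ Y : D₀ᵒᵖ, (BΛ.obj Y : Type w) →* Algebra.GrothendieckGroup (ΦR.obj Y)
  /-- naturality of `B₀^Λ → (Φ₀^ℝ)^gp` -/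
  divΛ_natural : ∀ {Y Y' : D₀ᵒᵖ} (f : Y ⟶ Y') (b : BΛ.obj Y),
    divΛ Y' ((BΛ.map f).hom b) = gpMap (ΦR.map f).hom (divΛ Y b)
  /-- `F₀^Λ ⊆ B₀^Λ` (Def 3.6 (i): `F₀`, `F₀^pf`, `ℝ·Φ₀^cnst`) -/
  FΛ : ∀ Y : D₀ᵒᵖ, Submonoid (BΛ.obj Y)
  /-- `F₀^Λ` is a subfunctor -/
  FΛ_map : ∀ {Y Y' : D₀ᵒᵖ} (f : Y ⟶ Y') (b : BΛ.obj Y), b ∈ FΛ Y → (BΛ.map f).hom b ∈ FΛ Y'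
  /-- `ℝ·Φ₀^cnst ⊆ (Φ₀^ℝ)^gp` (Def 3.6 (i); used in (ii)(a) as `(ℝ·Φ₀^cnst)|_D`); a subgroup (an
  `ℝ`-subspace of the `ℝ`-vector space `(Φ₀^ℝ)^gp`, [FrdI] Def 2.4 (i)) -/
  cnstR : ∀ Y : D₀ᵒᵖ, Subgroup (Algebra.GrothendieckGroup (ΦR.obj Y))
  /-- `ℝ·Φ₀^cnst` is stable under pull-back -/
  cnstR_map : ∀ {Y Y' : D₀ᵒᵖ} (f : Y ⟶ Y') (x : Algebra.GrothendieckGroup (ΦR.obj Y)),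
    x ∈ cnstR Y → gpMap (ΦR.map f).hom x ∈ cnstR Y'
  /-- `F₀^Λ` maps into `ℝ·Φ₀^cnst` (its image is `Φ₀^cnst`, `(Φ₀^cnst)^pf`, resp. `ℝ·Φ₀^cnst`) -/
  divΛ_mem_cnstR : ∀ (Y : D₀ᵒᵖ) (b : BΛ.obj Y), b ∈ FΛ Y → divΛ Y b ∈ cnstR Y
  /-- `ℝ·Φ₀^cnst` is root-closed in `(Φ₀^ℝ)^gp`: `g^n ∈ ℝ·Φ₀^cnst ⇒ g ∈ ℝ·Φ₀^cnst` (`n ≥ 1`) — given by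
  the printed "`ℝ`-vector SUBSPACE `ℝ·Φ₀^cnst ⊆ (Φ₀^ℝ)^gp`" of the uniquely divisible `(Φ₀^rlf)^gp`
  ([FrdI] Def 2.4 (i); Def 3.6 (i), p.76).  (v2: additive field — R-9 finding F2/N1 of abc-iut-L2-d2
  on p407532/p405462: over a bare subgroup `cnstR` the perfection clause of Remark 3.6.4,
  "`(Φ^pf)^{bs-fld}` is monoprime", is not provable as typed; with this field it is
  `Sec3Remark364.remark364_isMonoprime_bsFld_of_rootClosed`.)  NOT recorded: minimality of the span
  (needs the `ℝ`-action on `(Φ₀^ℝ)^gp`; supplied by a constructor from the tree's `IsPerfFactorial.Rlf`). -/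
  cnstR_root : ∀ (Y : D₀ᵒᵖ) (g : Algebra.GrothendieckGroup (ΦR.obj Y)) (n : ℕ+),
    g ^ (n : ℕ) ∈ cnstR Y → g ∈ cnstR Y
  /-- `Φ₀^cnst ⊆ ℝ·Φ₀^cnst`: the image in `(Φ₀^ℝ)^gp` [via `Φ₀^gp → (Φ₀^ℝ)^gp`] of `Φ₀^cnst` = "the image
  of `F₀` in `Φ₀^gp`" (Def 3.3 (iii), p.73) lies in the span `ℝ·Φ₀^cnst` (Def 3.6 (i), p.76), for every
  monoid type `Λ`.  (v2: additive field — the generation link N1 of abc-iut-L2-d2; v1 tied `ℝ·Φ₀^cnst`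
  to `F₀^Λ` only [`divΛ_mem_cnstR`], not to `F₀` itself.) -/
  cnst_le_cnstR : ∀ (Y : D₀ᵒᵖ) (b : B₀.obj Y), b ∈ F₀ Y → gpMap (toR Y) (div₀ Y b) ∈ cnstR Y
  /-- elements of `Φ₀^ℝ(Y)` arising from non-cuspidal log-divisors (Def 3.6 (iii), p.77) -/
  ncspR : ∀ Y : D₀ᵒᵖ, Submonoid (ΦR.obj Y)
  /-- elements of `Φ₀^ℝ(Y)` arising from cuspidal log-divisors (Def 3.6 (iii), p.77) -/
  cspR : ∀ Y : D₀ᵒᵖ, Submonoid (ΦR.obj Y)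
  /-- compatibility with `Φ₀ → Φ₀^ℝ` on non-cuspidal elements -/
  toR_ncsp : ∀ (Y : D₀ᵒᵖ) (x : Φ₀.obj Y), x ∈ ncsp₀ Y → toR Y x ∈ ncspR Y
  /-- compatibility with `Φ₀ → Φ₀^ℝ` on cuspidal elements -/
  toR_csp : ∀ (Y : D₀ᵒᵖ) (x : Φ₀.obj Y), x ∈ csp₀ Y → toR Y x ∈ cspR Y

namespace RealifiedDivisorMonoids

/-- `Φ₀^cnst ⊆ ℝ·Φ₀^cnst` (Def 3.6 (i), p.76) in subobject form: the image of `Φ₀^cnst(Y)`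
(`DivisorMonoids.cnst`, Def 3.3 (iii)) under `Φ₀^gp → (Φ₀^ℝ)^gp` is contained in `ℝ·Φ₀^cnst(Y)`.
[cite: MochizukiEtTh2009, Def 3.6 p.76] -/
theorem map_cnst_le_cnstR {V : FrdIMonoidStub.{w}} (T : RealifiedDivisorMonoids (D₀ := D₀) V)
    (Y : D₀ᵒᵖ) : (T.cnst Y).map (gpMap (T.toR Y)) ≤ (T.cnstR Y).toSubmonoid := by
  rintro _ ⟨_, ⟨b, hb, rfl⟩, rfl⟩
  exact T.cnst_le_cnstR Y b hb

/-- Root-closure of `ℝ·Φ₀^cnst` for exponents `n ≠ 0`. [cite: MochizukiEtTh2009, Def 3.6 p.76] -/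
theorem mem_cnstR_of_pow_mem {V : FrdIMonoidStub.{w}} (T : RealifiedDivisorMonoids (D₀ := D₀) V)
    (Y : D₀ᵒᵖ) {g : Algebra.GrothendieckGroup (T.ΦR.obj Y)} {n : ℕ} (hn : n ≠ 0)
    (hg : g ^ n ∈ T.cnstR Y) : g ∈ T.cnstR Y :=
  T.cnstR_root Y g ⟨n, Nat.pos_of_ne_zero hn⟩ hg

end RealifiedDivisorMonoids

/-! ## Definition 3.6 (ii) (pp.76–77): tempered Frobenioids -/

variable {V : FrdIMonoidStub.{w}}

/-- **Definition 3.6 (ii)** (pp.76–77). "Let `D` be a connected, totally epimorphic category,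
equipped with a functor `D → D₀`; `Φ ⊆ Φ^{ℝ-log} := Φ₀^ℝ|_D` a group-saturated [i.e., `Φ(A)` is
group-saturated in `Φ^{ℝ-log}(A)`, `∀ A ∈ Ob(D)`] subfunctor in monoids which determines a
perf-factorial divisorial monoid on `D` such that the following conditions are satisfied: (a) the
[necessarily group-saturated] submonoid `Φ^{bs-fld} := (ℝ·Φ₀^cnst)|_D ×_{(Φ^{ℝ-log})^gp} Φ ⊆ Φ^{ℝ-log}`
on `D` is monoprime [cf. [FrdI], §0]; (b) the image of the resulting homomorphism of group-like
monoids on `D`, `F := F₀^Λ|_D ×_{(Φ^{ℝ-log})^gp} Φ^gp → (Φ^{bs-fld})^gp … ⊆ (Φ^{ℝ-log})^gp` determines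
a subfunctor in nonzero monoids of `(Φ^{bs-fld})^gp` [i.e., for every `A ∈ Ob(D)`, the
homomorphism `F(A) → (Φ^{bs-fld})^gp(A)` is nonzero]. … Write `B := B₀^Λ|_D ×_{(Φ^{ℝ-log})^gp} Φ^gp → Φ^gp`.
Thus, the data `(D, Φ, B, B → Φ^gp)` determines a model Frobenioid `C` [cf. [FrdI], Theorem 5.2,
(ii)]. We shall refer to a Frobenioid `C` obtained in this way as a *tempered Frobenioid* and to `Λ`
as the *monoid type* of the tempered Frobenioid `C`." Here: the structure of this data and these
conditions; `V`, `VD` are the [FrdI] vocabularies not yet in the tree; the model-Frobenioid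
category is TODO-merge(abc-iut-L1-t2) (`Frobenioids.ModelFrobenioid`). In (b), "nonzero" is
rendered as: some element of `F₀^Λ(A)` has `(Φ^{ℝ-log})^gp`-component `x/y` with `x ≠ y ∈ Φ(A)`.
[cite: MochizukiEtTh2009, Def 3.6 p.77] -/
structure TemperedFrobenioid (T : RealifiedDivisorMonoids (D₀ := D₀) V) (D : Type u) [Category.{v} D]
    (VD : FrdICatStub.{u, v, w} D) : Type (max u₀ v₀ u v w) where
  /-- "`D` … a connected … category" -/
  isConnected : IsConnected D
  /-- "… totally epimorphic category" ([FrdI] §0) -/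
  isTotallyEpimorphic : IsTotallyEpimorphic D
  /-- "equipped with a functor `D → D₀`" -/
  base : D ⥤ D₀
  /-- `Φ ⊆ Φ^{ℝ-log} := Φ₀^ℝ|_D`, a subfunctor in monoids -/
  Φ : SubMonoidOn (base.op ⋙ T.ΦR)
  /-- "group-saturated [i.e., `Φ(A)` is group-saturated in `Φ^{ℝ-log}(A)`, `∀ A ∈ Ob(D)`]" (§0) -/
  isGroupSaturated : ∀ A : Dᵒᵖ, IsGroupSaturated (Φ.carrier A)
  /-- "which determines a perf-factorial … monoid on `D`" ([FrdI] Def 2.4 (i)) -/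
  isPerfFactorial : ∀ A : Dᵒᵖ, V.IsPerfFactorial (Φ.carrier A)
  /-- "… divisorial monoid on `D`" ([FrdI] Def 1.1) -/
  isDivisorialOn : VD.IsDivisorialOn Φ.toFunctor
  /-- (a) `Φ^{bs-fld}(A) = {x ∈ Φ(A) | x ∈ ℝ·Φ₀^cnst inside (Φ^{ℝ-log})^gp(A)}` is monoprime -/
  isMonoprime_bsFld : ∀ A : Dᵒᵖ, IsMonoprime
    ↥(Φ.carrier A ⊓ (T.cnstR (op (base.obj (unop A)))).toSubmonoid.comap Algebra.GrothendieckGroup.of)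
  /-- (b) "for every `A ∈ Ob(D)`, the homomorphism `F(A) → (Φ^{bs-fld})^gp(A)` is nonzero" -/
  exists_FΛ_div_ne : ∀ A : Dᵒᵖ, ∃ b ∈ T.FΛ (op (base.obj (unop A))),
    ∃ x ∈ Φ.carrier A, ∃ y ∈ Φ.carrier A, x ≠ y ∧
      T.divΛ _ b = Algebra.GrothendieckGroup.of x / Algebra.GrothendieckGroup.of y

namespace TemperedFrobenioid

variable {T : RealifiedDivisorMonoids (D₀ := D₀) V} {D : Type u} [Category.{v} D]
  {VD : FrdICatStub.{u, v, w} D} (C : TemperedFrobenioid T D VD)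

/-- The object `Y_A ∈ Ob(D₀)` under `A ∈ Ob(D)` via `D → D₀`, as an object of `D₀ᵒᵖ`.
[cite: MochizukiEtTh2009, Def 3.6 p.76] -/
abbrev baseOp (A : Dᵒᵖ) : D₀ᵒᵖ := op (C.base.obj (unop A))

/-- `Φ^{ℝ-log} := Φ₀^ℝ|_D` (Def 3.6 (ii), p.76). [cite: MochizukiEtTh2009, Def 3.6 p.76] -/
abbrev ΦRlog : Dᵒᵖ ⥤ CommMonCat.{w} := C.base.op ⋙ T.ΦR

/-- The *divisor monoid* `Φ` of the tempered Frobenioid as a monoid on `D` (the `Φ` of the data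
`(D, Φ, B, B → Φ^gp)`, p.77). [cite: MochizukiEtTh2009, Def 3.6 p.77] -/
def divisorMonoid : Dᵒᵖ ⥤ CommMonCat.{w} := C.Φ.toFunctor

/-- The monoid type `Λ` of the tempered Frobenioid (p.77). [cite: MochizukiEtTh2009, Def 3.6 p.77] -/
def monoidType (_C : TemperedFrobenioid T D VD) : MonoidType := T.Λ

/-- `Φ^{bs-fld} := (ℝ·Φ₀^cnst)|_D ×_{(Φ^{ℝ-log})^gp} Φ ⊆ Φ^{ℝ-log}` (Def 3.6 (ii)(a), p.77), as a
subfunctor in monoids of `Φ^{ℝ-log}`. [cite: MochizukiEtTh2009, Def 3.6 p.77] -/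
def bsFld : SubMonoidOn C.ΦRlog :=
  C.Φ.inter (fun A => (T.cnstR (C.baseOp A)).toSubmonoid.comap Algebra.GrothendieckGroup.of) fun f x hx => by
    change Algebra.GrothendieckGroup.of ((T.ΦR.map (C.base.map f.unop).op).hom x) ∈ T.cnstR _
    rw [← gpMap_of]
    exact T.cnstR_map _ _ hx

/-- `Φ^{bs-fld}(A) ⊆ Φ(A)`. [cite: MochizukiEtTh2009, Def 3.6 p.77] -/
theorem bsFld_le (A : Dᵒᵖ) : C.bsFld.carrier A ≤ C.Φ.carrier A := inf_le_left

/-- "(a) the [necessarily group-saturated] submonoid `Φ^{bs-fld}`" (Def 3.6 (ii), p.77): `Φ^{bs-fld}(A)`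
is group-saturated in `Φ^{ℝ-log}(A)` — PROVED from the group-saturatedness of `Φ` and the fact that
`ℝ·Φ₀^cnst` is a subgroup. [cite: MochizukiEtTh2009, Def 3.6 p.77] -/
theorem isGroupSaturated_bsFld (A : Dᵒᵖ) : IsGroupSaturated (C.bsFld.carrier A) := by
  rw [isGroupSaturated_iff']
  rintro q a ⟨haΦ, ha⟩ b ⟨hbΦ, hb⟩ hqb
  refine ⟨(isGroupSaturated_iff' _).1 (C.isGroupSaturated A) q a haΦ b hbΦ hqb, ?_⟩
  change Algebra.GrothendieckGroup.of q ∈ T.cnstR (C.baseOp A)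
  have hq : Algebra.GrothendieckGroup.of q =
      Algebra.GrothendieckGroup.of a / Algebra.GrothendieckGroup.of b := by
    rw [eq_div_iff_mul_eq', ← map_mul, hqb]
  rw [hq]
  exact (T.cnstR (C.baseOp A)).div_mem ha hb

/-- The inclusion `Φ(A)^gp → (Φ^{ℝ-log})^gp(A)` on groupifications.
[cite: MochizukiEtTh2009, Def 3.6 p.77] -/
noncomputable def ΦgpToRlog (A : Dᵒᵖ) :
    Algebra.GrothendieckGroup (C.Φ.carrier A) →* Algebra.GrothendieckGroup (T.ΦR.obj (C.baseOp A)) :=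
  gpMap (C.Φ.carrier A).subtype

/-- `B := B₀^Λ|_D ×_{(Φ^{ℝ-log})^gp} Φ^gp` at `A` (p.77): pairs `(b, ξ)` with `b ∈ B₀^Λ(Y_A)`,
`ξ ∈ Φ(A)^gp` and the same image in `(Φ^{ℝ-log})^gp(A)` — the *rational function monoid* of the
tempered Frobenioid. [cite: MochizukiEtTh2009, Def 3.6 p.77] -/
noncomputable def ratFn (A : Dᵒᵖ) :
    Submonoid ((T.BΛ.obj (C.baseOp A) : Type w) × Algebra.GrothendieckGroup (C.Φ.carrier A)) where
  carrier := {p | T.divΛ (C.baseOp A) p.1 = C.ΦgpToRlog A p.2}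
  one_mem' := by
    change T.divΛ (C.baseOp A) 1 = C.ΦgpToRlog A 1
    rw [map_one, map_one]
  mul_mem' {p q} hp hq := by
    change T.divΛ (C.baseOp A) (p.1 * q.1) = C.ΦgpToRlog A (p.2 * q.2)
    rw [map_mul, map_mul]
    exact congrArg₂ (· * ·) hp hq

/-- `Div_B : B(A) → Φ(A)^gp`, the second projection (the arrow `B → Φ^gp` of the data, p.77).
[cite: MochizukiEtTh2009, Def 3.6 p.77] -/
noncomputable def divB (A : Dᵒᵖ) : C.ratFn A →* Algebra.GrothendieckGroup (C.Φ.carrier A) :=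
  (MonoidHom.snd _ _).comp (C.ratFn A).subtype

/-- `F := F₀^Λ|_D ×_{(Φ^{ℝ-log})^gp} Φ^gp` at `A` (p.77): the elements of `B(A)` whose function
component is constant. [cite: MochizukiEtTh2009, Def 3.6 p.77] -/
noncomputable def cnstFn (A : Dᵒᵖ) :
    Submonoid ((T.BΛ.obj (C.baseOp A) : Type w) × Algebra.GrothendieckGroup (C.Φ.carrier A)) :=
  C.ratFn A ⊓ (T.FΛ (C.baseOp A)).comap (MonoidHom.fst _ _)

/-- `F(A) ⊆ B(A)`. [cite: MochizukiEtTh2009, Def 3.6 p.77] -/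
theorem cnstFn_le_ratFn (A : Dᵒᵖ) : C.cnstFn A ≤ C.ratFn A := inf_le_left

/-- "If `C` is of rational … type [a property which is completely determined by `Φ` — cf. [FrdI],
Definition 4.5, (ii)], then we shall say that `Φ` is *rational*" (p.77).
[cite: MochizukiEtTh2009, Def 3.6 p.77] -/
def IsRational : Prop := VD.IsRational C.divisorMonoid

/-- "… (respectively, strictly rational)" (p.77). [cite: MochizukiEtTh2009, Def 3.6 p.77] -/
def IsStrictlyRational : Prop := VD.IsStrictlyRational C.divisorMonoid

/-! ## Definition 3.6 (iii) (p.77): non-cuspidal and cuspidal elements and primes -/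

/-- **Definition 3.6 (iii)** (p.77): "an element of `Φ(A)` is *non-cuspidal* … if it arises [cf.
the inductive limit …] from a non-cuspidal … log-divisor". [cite: MochizukiEtTh2009, Def 3.6 p.77] -/
def IsNonCuspidal {A : Dᵒᵖ} (x : C.Φ.carrier A) : Prop := (x : C.ΦRlog.obj A) ∈ T.ncspR (C.baseOp A)

/-- **Definition 3.6 (iii)** (p.77): "… *cuspidal* if it arises … from a cuspidal log-divisor".
[cite: MochizukiEtTh2009, Def 3.6 p.77] -/
def IsCuspidal {A : Dᵒᵖ} (x : C.Φ.carrier A) : Prop := (x : C.ΦRlog.obj A) ∈ T.cspR (C.baseOp A)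

/-- `Φ(A)^ncsp ⊆ Φ(A)`, "the submonoid of non-cuspidal … elements" (p.77).
[cite: MochizukiEtTh2009, Def 3.6 p.77] -/
def ncsp (A : Dᵒᵖ) : Submonoid (C.Φ.carrier A) := (T.ncspR (C.baseOp A)).comap (C.Φ.carrier A).subtype

/-- `Φ(A)^csp ⊆ Φ(A)`, "the submonoid of … cuspidal elements" (p.77).
[cite: MochizukiEtTh2009, Def 3.6 p.77] -/
def csp (A : Dᵒᵖ) : Submonoid (C.Φ.carrier A) := (T.cspR (C.baseOp A)).comap (C.Φ.carrier A).subtype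

/-- "a prime `𝔭` of the monoid `Φ(A)` is *non-cuspidal* … if the primary elements of `Φ(A)` that are
contained in `𝔭` are non-cuspidal" (p.77); `Prime(Φ(A))^ncsp`. [cite: MochizukiEtTh2009, Def 3.6 p.77] -/
def ncspPrimes (A : Dᵒᵖ) : Set (Primes (C.Φ.carrier A)) :=
  {𝔭 | ∀ x ∈ 𝔭.carrier, C.IsNonCuspidal x}

/-- "… *cuspidal* if the primary elements … contained in `𝔭` are cuspidal" (p.77); `Prime(Φ(A))^csp`.
[cite: MochizukiEtTh2009, Def 3.6 p.77] -/
def cspPrimes (A : Dᵒᵖ) : Set (Primes (C.Φ.carrier A)) :=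
  {𝔭 | ∀ x ∈ 𝔭.carrier, C.IsCuspidal x}

/-! "We shall refer to a pre-step of `C` as non-cuspidal (respectively, cuspidal) if its zero
divisor is non-cuspidal (respectively, cuspidal)" (p.77): a predicate on morphisms of the model
Frobenioid `C`, i.e. on their zero divisors `Div(φ) ∈ Φ(A)` — it is `IsNonCuspidal (Div φ)` once
the category `C = ModelFrobenioid Φ B Div_B` (TODO-merge(abc-iut-L1-t2)) is available. -/

/-! ## Definition 3.6 (iv) (pp.77–78): the base-field-theoretic hull -/

/-- **Definition 3.6 (iv)** (pp.77–78): the divisor monoid `Φ^{bs-fld}` of "the data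
`(D, Φ^{bs-fld}, F, F → (Φ^{bs-fld})^gp)` [which] determines a model Frobenioid `C^{bs-fld}` … the
*base-field-theoretic hull* of the tempered Frobenioid `C`", as a monoid on `D`. The category
`C^{bs-fld}`, the faithful functor `C^{bs-fld} → C` and "`C^{bs-fld}` is a `p`-adic Frobenioid in the
sense of [FrdII], Example 1.1, (ii)" are TODO-merge(abc-iut-L1-t2) (model Frobenioids) /
TODO-merge(abc-iut-L1-t4) (`p`-adic Frobenioids). [cite: MochizukiEtTh2009, Def 3.6 p.78] -/
def bsFldMonoid : Dᵒᵖ ⥤ CommMonCat.{w} := C.bsFld.toFunctor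

/-- **Definition 3.6 (iv)** (p.78): "we shall refer to a morphism of the Frobenioid `C` as
*base-field-theoretic* if its zero divisor belongs to `Φ^{bs-fld}(-) ⊆ Φ(-)`" — the predicate on zero
divisors. [cite: MochizukiEtTh2009, Def 3.6 p.78] -/
def IsBaseFieldTheoreticDiv {A : Dᵒᵖ} (x : C.Φ.carrier A) : Prop :=
  (x : C.ΦRlog.obj A) ∈ C.bsFld.carrier A

/-! ## Definition 3.6 (v) (p.78): cuspidally pure -/

/-- **Definition 3.6 (v)** (p.78): "`Φ` is *cuspidally pure* if …: (a) for every non-cuspidal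
primary element `x ∈ Φ(A)`, where `A ∈ Ob(D)`, there exists an element `y ∈ Φ^{bs-fld}(A)` such that
`x ≤ y`; (b) we have `Prime(Φ(A)) = Prime(Φ(A))^ncsp ∪ Prime(Φ(A))^csp` [disjoint union] for every
`A ∈ Ob(D)`." (`x ≤ y` is divisibility in the multiplicative notation.)
[cite: MochizukiEtTh2009, Def 3.6 p.78] -/
structure IsCuspidallyPure : Prop where
  /-- (a) every non-cuspidal primary element is bounded by a base-field-theoretic element -/
  exists_bsFld_dvd : ∀ (A : Dᵒᵖ) (x : C.Φ.carrier A), IsPrimary x → C.IsNonCuspidal x →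
    ∃ y : C.Φ.carrier A, C.IsBaseFieldTheoreticDiv y ∧ x ∣ y
  /-- (b) every prime is non-cuspidal or cuspidal … -/
  ncsp_or_csp : ∀ (A : Dᵒᵖ) (𝔭 : Primes (C.Φ.carrier A)), 𝔭 ∈ C.ncspPrimes A ∨ 𝔭 ∈ C.cspPrimes A
  /-- (b) … and not both (disjoint union) -/
  not_ncsp_and_csp : ∀ (A : Dᵒᵖ) (𝔭 : Primes (C.Φ.carrier A)),
    ¬ (𝔭 ∈ C.ncspPrimes A ∧ 𝔭 ∈ C.cspPrimes A)

end TemperedFrobenioid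

end Literature.AnabelianGeometry.EtaleTheta
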